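import Summits.CriticalPhenomena.PercolationContinuityZ3.Theorems.PercNearOneGluingNoHeavyLowerTailThresholdRABStrict

/-!
# `NoHeavyLowerTail` (crux stmt-CriticalPhenomena-4575), lane prim-ineq-gen-4 (gen 30): the ANTI-BIAS LEMMA

Support file (`--supports stmt-CriticalPhenomena-4575`; memo `run/shared/lean/prim/prim-ineq-gen-4/FINDING-SLACK-INDUCTION-g30.md` §7, (TT2)).
Pure finite combinatorics, no definitions, no `sorry`, standard axioms.  Companion of `…AntiBandVerticalBias` (vertical-bias lemma and sharp
single-coordinate lemma).

For an up-set `A` of subsets of a `2m`-set and a point `i`, write `P_l = #{y ∈ A | #y = l ∧ i ∈ y}`, `N_l = #{y ∈ A | #y = l ∧ i ∉ y}` and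
`piv_k(A) = #{x | k ∉ x, x ∉ A, insert k x ∈ A}` (pivotal edges in direction `k`).  The single-coordinate lemma bounds the POSITIVE middle-layer
bias by the pivotal edges of the SAME coordinate: `2(P_m − N_m) ≤ piv_i(A)`.  The anti-bias lemma bounds the NEGATIVE bias by the pivotal edges
of the OTHER coordinates:

  `two_m_mul_card_mid_not_mem_le`:  `2m · N_m ≤ 2m · P_m + Σ_{k ≠ i} piv_k(A)`,

sharp for `A = {x | m ≤ #(x \ {i})}` (coordinate `i` a dummy with slice influence `−1`).  In probabilistic terms:
`−d_i(1_A) ≤ Σ_{k≠i} I_k(1_A) / (2m · P(#x = m))`: a coordinate can be strongly anti-correlated with `A` on the middle slice only if the other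
coordinates carry proportional total influence — the quantitative form of "dummies of `A` have negative slice influence" used in the slack
induction of the memo.  Proof: two double counts of the edges between the middle levels inside the sections `i ∉ x` and `i ∈ x`
(`mul_card_mid_not_mem_le`, `mul_card_succ_mem_le`) and the injections `N_{m−1} ≤ P_m`, `N_m ≤ P_{m+1}` (`card_not_mem_level_le_card_mem_succ`).
-/

namespace Summit.CriticalPhenomena.PercolationContinuityZ3.Theorems.AntiBandAntiBias

open Finset
open scoped FinsetFamily

variable {α : Type*} [DecidableEq α] [Fintype α]

omit [Fintype α] in
/-- Injection `x ↦ insert i x`: the members of level `l` avoiding `i` are at most as many as the members of level `l + 1` containing `i`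
(the layer influence of `i` between levels `l` and `l+1` is non-negative). [folklore] -/
theorem card_not_mem_level_le_card_mem_succ (A : Finset (Finset α)) (hA : IsUpperSet (A : Set (Finset α))) (i : α) (l : ℕ) :
    #(A.filter fun x => #x = l ∧ i ∉ x) ≤ #(A.filter fun y => #y = l + 1 ∧ i ∈ y) := by
  refine card_le_card_of_injOn (fun x => insert i x) ?_ ?_
  · intro x hx
    rw [mem_coe, mem_filter] at hx
    rw [mem_coe, mem_filter]
    exact ⟨hA (subset_insert i x) hx.1, by rw [card_insert_of_notMem hx.2.2, hx.2.1], mem_insert_self i x⟩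
  · intro x hx y hy h
    have hxi := (mem_filter.1 hx).2.2
    have hyi := (mem_filter.1 hy).2.2
    simp only at h
    rw [← erase_insert hxi, ← erase_insert hyi, h]

/-- Double count below the middle: with `N_l = #{y ∈ A | #y = l ∧ i ∉ y}`, the pivotal edges `(x, k)`, `k ≠ i`, with `#x = m − 1`, `i ∉ x`
number at least `m·N_m − m·N_{m−1}` (each `y ∈ A_m` avoiding `i` has `m` lower neighbours avoiding `i`; those inside `A` are at most `m·N_{m−1}`). [this work] -/
theorem mul_card_mid_not_mem_le (m : ℕ) (hα : Fintype.card α = 2 * m) (A : Finset (Finset α)) (i : α) :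
    m * #(A.filter fun y => #y = m ∧ i ∉ y)
      ≤ m * #(A.filter fun y => #y = m - 1 ∧ i ∉ y)
        + ∑ k ∈ univ.erase i, #(((univ : Finset (Finset α)).filter fun x => k ∉ x ∧ x ∉ A ∧ insert k x ∈ A).filter
            fun x => #x = m - 1 ∧ i ∉ x) := by
  have hm : 1 ≤ m := by have := Fintype.card_pos_iff.2 ⟨i⟩; omega
  set Nm := A.filter fun y => #y = m ∧ i ∉ y with hNm
  set Nm1 := A.filter fun y => #y = m - 1 ∧ i ∉ y with hNm1
  -- T = pairs (y, k) with y ∈ Nm, k ∈ y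
  set T := Nm.sigma fun y => (y : Finset α) with hT
  have hTcard : #T = m * #Nm := by
    rw [hT, card_sigma, sum_const_nat (m := m) fun y hy => (mem_filter.1 hy).2.1, mul_comm]
  set Tin := T.filter fun p => p.1.erase p.2 ∈ A with hTin
  set Tout := T.filter fun p => ¬ p.1.erase p.2 ∈ A with hTout
  have hsplit : #Tin + #Tout = #T := card_filter_add_card_filter_not _
  -- Tin injects into pairs (x, k) with x ∈ Nm1, k ∈ (univ \ x).erase i
  have hin : #Tin ≤ m * #Nm1 := by
    have hc : #(Nm1.sigma fun x => (univ \ x).erase i) = m * #Nm1 := by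
      rw [card_sigma, sum_const_nat (m := m), mul_comm]
      intro x hx
      have hxc := (mem_filter.1 hx).2.1
      have hxi := (mem_filter.1 hx).2.2
      rw [card_erase_of_mem (mem_sdiff.2 ⟨mem_univ i, hxi⟩), card_sdiff_of_subset (subset_univ x), card_univ, hα, hxc]
      omega
    rw [← hc]
    refine card_le_card_of_injOn (fun p => (⟨p.1.erase p.2, p.2⟩ : Σ _ : Finset α, α)) ?_ ?_
    · intro p hp
      rw [mem_coe, hTin, mem_filter, hT, mem_sigma] at hp
      obtain ⟨⟨hy, hk⟩, hxA⟩ := hp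
      rw [hNm, mem_filter] at hy
      show (⟨p.1.erase p.2, p.2⟩ : Σ _ : Finset α, α) ∈ Nm1.sigma fun x => (univ \ x).erase i
      rw [mem_sigma]
      refine ⟨?_, ?_⟩
      · show p.1.erase p.2 ∈ Nm1
        rw [hNm1, mem_filter]
        exact ⟨hxA, by rw [card_erase_of_mem hk, hy.2.1], fun h => hy.2.2 (mem_of_mem_erase h)⟩
      · show p.2 ∈ (univ \ p.1.erase p.2).erase i
        rw [mem_erase, mem_sdiff]
        exact ⟨fun h => hy.2.2 (h ▸ hk), mem_univ _, notMem_erase _ _⟩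
    · intro p hp q hq h
      rw [mem_coe, hTin, mem_filter, hT, mem_sigma] at hp hq
      simp only [Sigma.mk.inj_iff, heq_eq_eq] at h
      obtain ⟨h1, h2⟩ := h
      have hp1 : p.1 = q.1 := by rw [← insert_erase hp.1.2, ← insert_erase hq.1.2, h1, h2]
      exact Sigma.ext hp1 (heq_of_eq h2)
  -- Tout injects into the pivotal pairs
  have hout : #Tout ≤ ∑ k ∈ univ.erase i, #(((univ : Finset (Finset α)).filter fun x => k ∉ x ∧ x ∉ A ∧ insert k x ∈ A).filter
      fun x => #x = m - 1 ∧ i ∉ x) := by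
    rw [← card_sigma]
    refine card_le_card_of_injOn (fun p => (⟨p.2, p.1.erase p.2⟩ : Σ _ : α, Finset α)) ?_ ?_
    · intro p hp
      rw [mem_coe, hTout, mem_filter, hT, mem_sigma] at hp
      obtain ⟨⟨hy, hk⟩, hxA⟩ := hp
      rw [hNm, mem_filter] at hy
      show (⟨p.2, p.1.erase p.2⟩ : Σ _ : α, Finset α) ∈ (univ.erase i).sigma fun k =>
        ((univ : Finset (Finset α)).filter fun x => k ∉ x ∧ x ∉ A ∧ insert k x ∈ A).filter fun x => #x = m - 1 ∧ i ∉ x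
      rw [mem_sigma]
      refine ⟨?_, ?_⟩
      · show p.2 ∈ univ.erase i
        rw [mem_erase]
        exact ⟨fun h => hy.2.2 (h ▸ hk), mem_univ _⟩
      · show p.1.erase p.2 ∈ ((univ : Finset (Finset α)).filter fun x => p.2 ∉ x ∧ x ∉ A ∧ insert p.2 x ∈ A).filter
            fun x => #x = m - 1 ∧ i ∉ x
        rw [mem_filter, mem_filter]
        exact ⟨⟨mem_univ _, notMem_erase _ _, hxA, by rw [insert_erase hk]; exact hy.1⟩,
          by rw [card_erase_of_mem hk, hy.2.1], fun h => hy.2.2 (mem_of_mem_erase h)⟩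
    · intro p hp q hq h
      rw [mem_coe, hTout, mem_filter, hT, mem_sigma] at hp hq
      simp only [Sigma.mk.inj_iff, heq_eq_eq] at h
      obtain ⟨h1, h2⟩ := h
      have hp1 : p.1 = q.1 := by rw [← insert_erase hp.1.2, ← insert_erase hq.1.2, h2, h1]
      exact Sigma.ext hp1 (heq_of_eq h1)
  omega

/-- Double count above the middle: with `P_l = #{y ∈ A | #y = l ∧ i ∈ y}`, the pivotal edges `(x, k)`, `k ≠ i`, with `#x = m`, `i ∈ x` number at
least `m·P_{m+1} − m·P_m`. [this work] -/
theorem mul_card_succ_mem_le (m : ℕ) (hα : Fintype.card α = 2 * m) (A : Finset (Finset α)) (i : α) :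
    m * #(A.filter fun y => #y = m + 1 ∧ i ∈ y)
      ≤ m * #(A.filter fun y => #y = m ∧ i ∈ y)
        + ∑ k ∈ univ.erase i, #(((univ : Finset (Finset α)).filter fun x => k ∉ x ∧ x ∉ A ∧ insert k x ∈ A).filter
            fun x => #x = m ∧ i ∈ x) := by
  set Pm1 := A.filter fun y => #y = m + 1 ∧ i ∈ y with hPm1
  set Pm := A.filter fun y => #y = m ∧ i ∈ y with hPm
  set T := Pm1.sigma fun y => (y.erase i : Finset α) with hT
  have hTcard : #T = m * #Pm1 := by
    rw [hT, card_sigma, sum_const_nat (m := m), mul_comm]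
    intro y hy
    rw [card_erase_of_mem (mem_filter.1 hy).2.2, (mem_filter.1 hy).2.1]
    rfl
  set Tin := T.filter fun p => p.1.erase p.2 ∈ A with hTin
  set Tout := T.filter fun p => ¬ p.1.erase p.2 ∈ A with hTout
  have hsplit : #Tin + #Tout = #T := card_filter_add_card_filter_not _
  have hin : #Tin ≤ m * #Pm := by
    have hc : #(Pm.sigma fun x => univ \ x) = m * #Pm := by
      rw [card_sigma, sum_const_nat (m := m), mul_comm]
      intro x hx
      rw [card_sdiff_of_subset (subset_univ x), card_univ, hα, (mem_filter.1 hx).2.1]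
      omega
    rw [← hc]
    refine card_le_card_of_injOn (fun p => (⟨p.1.erase p.2, p.2⟩ : Σ _ : Finset α, α)) ?_ ?_
    · intro p hp
      rw [mem_coe, hTin, mem_filter, hT, mem_sigma] at hp
      obtain ⟨⟨hy, hk⟩, hxA⟩ := hp
      rw [hPm1, mem_filter] at hy
      rw [mem_erase] at hk
      show (⟨p.1.erase p.2, p.2⟩ : Σ _ : Finset α, α) ∈ Pm.sigma fun x => univ \ x
      rw [mem_sigma]
      refine ⟨?_, ?_⟩
      · show p.1.erase p.2 ∈ Pm
        rw [hPm, mem_filter]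
        refine ⟨hxA, ?_, mem_erase.2 ⟨fun h => hk.1 h.symm, hy.2.2⟩⟩
        rw [card_erase_of_mem hk.2, hy.2.1]; rfl
      · show p.2 ∈ univ \ p.1.erase p.2
        rw [mem_sdiff]
        exact ⟨mem_univ _, notMem_erase _ _⟩
    · intro p hp q hq h
      rw [mem_coe, hTin, mem_filter, hT, mem_sigma, mem_erase] at hp hq
      simp only [Sigma.mk.inj_iff, heq_eq_eq] at h
      obtain ⟨h1, h2⟩ := h
      have hp1 : p.1 = q.1 := by rw [← insert_erase hp.1.2.2, ← insert_erase hq.1.2.2, h1, h2]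
      exact Sigma.ext hp1 (heq_of_eq h2)
  have hout : #Tout ≤ ∑ k ∈ univ.erase i, #(((univ : Finset (Finset α)).filter fun x => k ∉ x ∧ x ∉ A ∧ insert k x ∈ A).filter
      fun x => #x = m ∧ i ∈ x) := by
    rw [← card_sigma]
    refine card_le_card_of_injOn (fun p => (⟨p.2, p.1.erase p.2⟩ : Σ _ : α, Finset α)) ?_ ?_
    · intro p hp
      rw [mem_coe, hTout, mem_filter, hT, mem_sigma, mem_erase] at hp
      obtain ⟨⟨hy, hki, hk⟩, hxA⟩ := hp
      rw [hPm1, mem_filter] at hy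
      show (⟨p.2, p.1.erase p.2⟩ : Σ _ : α, Finset α) ∈ (univ.erase i).sigma fun k =>
        ((univ : Finset (Finset α)).filter fun x => k ∉ x ∧ x ∉ A ∧ insert k x ∈ A).filter fun x => #x = m ∧ i ∈ x
      rw [mem_sigma]
      refine ⟨mem_erase.2 ⟨hki, mem_univ _⟩, ?_⟩
      show p.1.erase p.2 ∈ ((univ : Finset (Finset α)).filter fun x => p.2 ∉ x ∧ x ∉ A ∧ insert p.2 x ∈ A).filter
          fun x => #x = m ∧ i ∈ x
      rw [mem_filter, mem_filter]
      refine ⟨⟨mem_univ _, notMem_erase _ _, hxA, by rw [insert_erase hk]; exact hy.1⟩, ?_, mem_erase.2 ⟨fun h => hki h.symm, hy.2.2⟩⟩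
      rw [card_erase_of_mem hk, hy.2.1]; rfl
    · intro p hp q hq h
      rw [mem_coe, hTout, mem_filter, hT, mem_sigma, mem_erase] at hp hq
      simp only [Sigma.mk.inj_iff, heq_eq_eq] at h
      obtain ⟨h1, h2⟩ := h
      have hp1 : p.1 = q.1 := by rw [← insert_erase hp.1.2.2, ← insert_erase hq.1.2.2, h2, h1]
      exact Sigma.ext hp1 (heq_of_eq h1)
  omega

/-- **Anti-bias lemma** (sharp).  For an up-set `A` of subsets of a `2m`-set and a point `i`:
`2m·#{y ∈ A | #y = m ∧ i ∉ y} ≤ 2m·#{y ∈ A | #y = m ∧ i ∈ y} + Σ_{k ≠ i} #{pivotal k-edges of A}`,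
i.e. `n` times the bias of the middle layer AGAINST `i` is at most the total number of pivotal edges in the other directions
(probabilistic form: `−d_i(1_A) ≤ Σ_{k≠i} I_k(1_A) / (2m·P(#x = m))`; equality for `A = {x | m ≤ #(x \ {i})}`, whose coordinate `i` is a dummy
with slice influence `−1`).  Memo FINDING-SLACK-INDUCTION-g30 §7 (TT2).  Proof: the two double counts above and the injections
`N_{m−1} ≤ P_m`, `N_m ≤ P_{m+1}`. [this work] -/
theorem two_m_mul_card_mid_not_mem_le (m : ℕ) (hα : Fintype.card α = 2 * m) (A : Finset (Finset α))
    (hA : IsUpperSet (A : Set (Finset α))) (i : α) :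
    2 * m * #(A.filter fun y => #y = m ∧ i ∉ y)
      ≤ 2 * m * #(A.filter fun y => #y = m ∧ i ∈ y)
        + ∑ k ∈ univ.erase i, #((univ : Finset (Finset α)).filter fun x => k ∉ x ∧ x ∉ A ∧ insert k x ∈ A) := by
  have hm : 1 ≤ m := by have := Fintype.card_pos_iff.2 ⟨i⟩; omega
  have hL := mul_card_mid_not_mem_le m hα A i
  have hU := mul_card_succ_mem_le m hα A i
  have h1 := card_not_mem_level_le_card_mem_succ A hA i (m - 1)
  rw [show m - 1 + 1 = m by omega] at h1
  have h2 := card_not_mem_level_le_card_mem_succ A hA i m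
  have h1' := Nat.mul_le_mul_left m h1
  have h2' := Nat.mul_le_mul_left m h2
  -- the two families of restricted pivotal sets are disjoint parts of the pivotal sets
  have hS : ∑ k ∈ univ.erase i, #(((univ : Finset (Finset α)).filter fun x => k ∉ x ∧ x ∉ A ∧ insert k x ∈ A).filter
        fun x => #x = m - 1 ∧ i ∉ x)
      + ∑ k ∈ univ.erase i, #(((univ : Finset (Finset α)).filter fun x => k ∉ x ∧ x ∉ A ∧ insert k x ∈ A).filter
        fun x => #x = m ∧ i ∈ x)
      ≤ ∑ k ∈ univ.erase i, #((univ : Finset (Finset α)).filter fun x => k ∉ x ∧ x ∉ A ∧ insert k x ∈ A) := by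
    rw [← sum_add_distrib]
    refine sum_le_sum fun k _ => ?_
    rw [← card_union_of_disjoint]
    · exact card_le_card (union_subset (filter_subset _ _) (filter_subset _ _))
    · rw [disjoint_filter]
      intro x _ h1 h2
      exact h1.2 h2.2
  have key : 2 * m * #(A.filter fun y => #y = m ∧ i ∉ y) = m * #(A.filter fun y => #y = m ∧ i ∉ y) + m * #(A.filter fun y => #y = m ∧ i ∉ y) := by ring
  have key2 : 2 * m * #(A.filter fun y => #y = m ∧ i ∈ y) = m * #(A.filter fun y => #y = m ∧ i ∈ y) + m * #(A.filter fun y => #y = m ∧ i ∈ y) := by ring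
  omega

end Summit.CriticalPhenomena.PercolationContinuityZ3.Theorems.AntiBandAntiBias
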